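import Literature.Computability.AlgebraicComplexity.BILPS19MinrankVarieties
import Literature.Computability.AlgebraicComplexity.BILPS19Cor25OfThm24
import Mathlib.LinearAlgebra.Matrix.Kronecker
import Mathlib.RingTheory.Nilpotent.Basic
import HarnessLib

/-!
# BILPS Thm 24 (Koszul flattening rank bound) and Cor 25 — DISCHARGED

Proof file (theorem-only, 0 named facts) for `BILPS2019_thm24` and `BILPS2019_cor25` of
`BILPS19MinrankVarieties.lean` (Bläser–Ikenmeyer–Lysikov–Pandey–Schreyer, arXiv:1911.02534, §7.2,
Thm 24 p0025:L50–75, Cor 25 p0025:L77–p0026:L3).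

Printed proof of Thm 24: "If `T ∈ 𝓜_r`, then it can be written as `x ⊗ A + T'` where `x ∈ U*`,
`rk(A) ≤ r` and `T' ∈ H ⊗ V* ⊗ W*` for some hyperplane `H ⊂ U*` which does not contain `x`. The
space `Λ^p U*` can be decomposed as `Λ^p H ⊕ (u ∧ Λ^{p-1} H)` … the map `F_{T,p}` is given by the
`2 × 2` block matrix `[[F_{T',p}, 0], [(I_p u) ⊗ A, F_{T',p-1}]]`. The rank of this matrix is at most
the sum of the ranks of the three blocks. The block `I_p u ⊗ A` has rank `dim Λ^p H · rk A =
C(k-1,p) r`. The ranks of other two blocks are bounded by their sizes".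

Formalisation (every field; the typed `[IsAlgClosed F] [CharZero F]` of §7 are not used). The
typed Koszul matrix `koszulMatrix p T` lives in the STANDARD basis `e_S` (`S ∈ ExtIdx k p`, the
tree's `extMulMatrix` = `L_{e_i} : Λ^p → Λ^{p+1}` of `DM16NonCommutativeRank.lean`) and equals
`Σ_i L_{e_i} ⊗ A_i` (`koszulMatrix_eq_sum_kronecker`). The printed change of basis of `U` is carried
out by conjugating with the exterior powers of the shear `ψ : e_j ↦ e_j + c_j e_a`
(`c_j = x_j / x_a`, `c_a = 0`, `x` the minrank witness, `x_a ≠ 0`): `Λ(ψ) = 1 + Σ_i c_i L_{e_a} L_{e_i}ᵀ`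
(contraction `L_{e_i}ᵀ` then wedge with `e_a`) is unipotent (`shearNil_mul_self`), and the
functoriality `Λ^{q+2}(ψ) L_{e_j} = L_{ψ e_j} Λ^{q+1}(ψ)` (`shear_mul_extMulMatrix`) follows from the
two exterior-algebra identities `L_{e_a} L_{e_i} = -L_{e_i} L_{e_a}` (polarised from the tree's
`L_v ∘ L_v = 0`) and the canonical anticommutation relation `L_{e_b}ᵀ L_{e_i} + L_{e_i} L_{e_b}ᵀ =
δ_{ib}` (`extMulMatrix_transpose_mul_extMulMatrix`). Conjugation replaces the `a`-th slice of `T` by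
`(1/x_a)·(Tx)ᵀ` (rank `≤ r`) and keeps the rank of `F_{T,p}` (`rank_koszulMatrix_shear`); for such a
tensor `F_{T,p} = F_{T₀,p} + L_{e_a} ⊗ A'_a` with `T₀` the tensor without its `a`-th slice, and
`F_{T₀,p}` is block diagonal for the row/column partition `a ∈ S` / `a ∉ S` (the blocks
`F_{T',p}`, `F_{T',p-1}` of the print), whence the bound
`rk ≤ C(k−1,p) r + min(C(k−1,p+1)n, C(k−1,p)m) + min(C(k−1,p)n, C(k−1,p−1)m)`
(`rank_koszulMatrix_le_of_mem_minrankSet`), which is the printed rational-valued bound after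
`C(k−1,p+1) = C(k−1,p)(k−p−1)/(p+1)` and `C(k−1,p−1) = C(k−1,p)p/(k−p)`. Cor 25 is then discharged
BY NAME through x5's glue `BILPS2019_cor25_of_thm24` (`BILPS19Cor25OfThm24.lean`).

Honest framing (val-lit, row X5-BILPS19): discharges of two typed literature facts (Koszul
flattening equations for minrank varieties); nothing here bears on `VP ≠ VNP`, which is NOT proved.
-/

noncomputable section

namespace Literature.Computability.AlgebraicComplexity

open Matrix

section ExteriorIdentities

variable {R : Type*} [CommRing R] {k : ℕ}

/-- `L_{c e_a} = c · L_{e_a}`: the exterior multiplication matrix of a scaled basis vector.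
[cite: BlaserIkenmeyerLysikovPandeySchreyer2019, §7.2 (Koszul flattenings)] -/
theorem extMulVec_single (q : ℕ) (a : Fin k) (c : R) :
    extMulVec R k q (Pi.single a c) = c • extMulMatrix R k q a := by
  unfold extMulVec
  rw [Finset.sum_eq_single a (fun j _ hj => by rw [Pi.single_eq_of_ne hj, zero_smul])
    (fun h => absurd (Finset.mem_univ a) h), Pi.single_eq_same]

/-- `L_{v + w} = L_v + L_w`. [cite: BlaserIkenmeyerLysikovPandeySchreyer2019, §7.2 (Koszul flattenings)] -/
theorem extMulVec_add (q : ℕ) (v w : Fin k → R) :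
    extMulVec R k q (v + w) = extMulVec R k q v + extMulVec R k q w := by
  unfold extMulVec
  simp [add_smul, Finset.sum_add_distrib]

/-- `e_a ∧ e_a ∧ (·) = 0`: `L_{e_a} ∘ L_{e_a} = 0`.
[cite: BlaserIkenmeyerLysikovPandeySchreyer2019, §7.2 (Koszul flattenings)] -/
theorem extMulMatrix_succ_mul_extMulMatrix_self (q : ℕ) (a : Fin k) :
    extMulMatrix R k (q + 1) a * extMulMatrix R k q a = 0 := by
  have h := extMulVec_succ_mul_extMulVec (R := R) (n := k) (p := q) (Pi.single a 1)
  rwa [extMulVec_single, extMulVec_single, one_smul, one_smul] at h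

/-- Anticommutation `e_a ∧ e_i ∧ (·) = - e_i ∧ e_a ∧ (·)`: `L_{e_a} L_{e_i} = -L_{e_i} L_{e_a}`
(polarisation of `L_v ∘ L_v = 0`). [cite: BlaserIkenmeyerLysikovPandeySchreyer2019, §7.2 (Koszul flattenings)] -/
theorem extMulMatrix_succ_mul_extMulMatrix_comm (q : ℕ) (a i : Fin k) :
    extMulMatrix R k (q + 1) a * extMulMatrix R k q i =
      -(extMulMatrix R k (q + 1) i * extMulMatrix R k q a) := by
  rw [eq_neg_iff_add_eq_zero]
  have h := extMulVec_succ_mul_extMulVec (R := R) (n := k) (p := q)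
    (Pi.single a 1 + Pi.single i 1)
  rw [extMulVec_add, extMulVec_add, extMulVec_single, extMulVec_single, extMulVec_single,
    extMulVec_single] at h
  simp only [one_smul] at h
  rw [Matrix.add_mul, Matrix.mul_add, Matrix.mul_add, extMulMatrix_succ_mul_extMulMatrix_self,
    extMulMatrix_succ_mul_extMulMatrix_self, zero_add, add_zero] at h
  exact h

/-- Entries of `L_{e_i}`. [cite: BlaserIkenmeyerLysikovPandeySchreyer2019, §7.2 (Koszul flattenings)] -/
theorem extMulMatrix_apply (q : ℕ) (i : Fin k) (T : ExtIdx k (q + 1)) (S : ExtIdx k q) :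
    extMulMatrix R k q i T S = if T.1 = insert i S.1 then wedgeSign R i S.1 else 0 := rfl

/-- If `T = insert i S` with `|T| = |S| + 1` then `i ∉ S`.
[cite: BlaserIkenmeyerLysikovPandeySchreyer2019, §7.2 (Koszul flattenings)] -/
theorem not_mem_of_eq_insert {q : ℕ} {i : Fin k} {T : ExtIdx k (q + 1)} {S : ExtIdx k q}
    (h : T.1 = insert i S.1) : i ∉ S.1 := by
  intro hi
  have hc := T.2
  rw [h, Finset.insert_eq_of_mem hi, S.2] at hc
  omega

/-- The sign identity behind the anticommutator of wedge and contraction: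
`ε(b, S ∪ i) ε(i, S ∪ b) = -ε(i, S) ε(b, S)` for `i ≠ b` not in `S`.
[cite: BlaserIkenmeyerLysikovPandeySchreyer2019, §7.2 (Koszul flattenings)] -/
theorem wedgeSign_insert_mul_wedgeSign_insert {i b : Fin k} (hib : i ≠ b) {S : Finset (Fin k)}
    (hi : i ∉ S) (hb : b ∉ S) :
    wedgeSign R b (insert i S) * wedgeSign R i (insert b S) =
      -(wedgeSign R i S * wedgeSign R b S) := by
  rcases lt_or_gt_of_ne hib with h | h
  · rw [wedgeSign_insert_of_gt h hi, wedgeSign_insert_of_lt h]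
    ring
  · rw [wedgeSign_insert_of_lt h, wedgeSign_insert_of_gt h hb]
    ring

/-- **The canonical anticommutation relation** between contraction with `e_b^*` (the transpose
`L_{e_b}ᵀ`) and wedge with `e_i`: `L_{e_b}ᵀ L_{e_i} + L_{e_i} L_{e_b}ᵀ = δ_{ib}` on `Λ^{q+1}`.
[cite: BlaserIkenmeyerLysikovPandeySchreyer2019, §7.2 (Koszul flattenings)] -/
theorem extMulMatrix_transpose_mul_extMulMatrix (q : ℕ) (b i : Fin k) :
    (extMulMatrix R k (q + 1) b)ᵀ * extMulMatrix R k (q + 1) i =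
      -(extMulMatrix R k q i * (extMulMatrix R k q b)ᵀ) +
        (if i = b then (1 : Matrix (ExtIdx k (q + 1)) (ExtIdx k (q + 1)) R) else 0) := by
  classical
  ext S U
  -- left-hand side: the single term at `insert b S` (present iff `b ∉ S`)
  have hL : ((extMulMatrix R k (q + 1) b)ᵀ * extMulMatrix R k (q + 1) i) S U =
      if b ∉ S.1 ∧ insert b S.1 = insert i U.1 then wedgeSign R b S.1 * wedgeSign R i U.1
      else 0 := by
    rw [Matrix.mul_apply]
    by_cases hbS : b ∈ S.1
    · rw [if_neg (fun h => h.1 hbS)]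
      refine Finset.sum_eq_zero fun V _ => ?_
      rw [Matrix.transpose_apply, extMulMatrix_apply]
      rw [if_neg, zero_mul]
      intro hV
      have := V.2
      rw [hV, Finset.insert_eq_of_mem hbS, S.2] at this
      omega
    · let V₀ : ExtIdx k (q + 2) :=
        ⟨insert b S.1, by rw [Finset.card_insert_of_notMem hbS, S.2]⟩
      rw [Finset.sum_eq_single V₀]
      · rw [Matrix.transpose_apply, extMulMatrix_apply, extMulMatrix_apply, if_pos rfl]
        by_cases h : insert b S.1 = insert i U.1
        · rw [if_pos (show V₀.1 = insert i U.1 from h), if_pos ⟨hbS, h⟩]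
        · rw [if_neg (show ¬ V₀.1 = insert i U.1 from h), if_neg (fun h' => h h'.2), mul_zero]
      · intro V _ hV
        rw [Matrix.transpose_apply, extMulMatrix_apply, if_neg, zero_mul]
        exact fun h => hV (Subtype.ext h)
      · exact fun h => absurd (Finset.mem_univ _) h
  -- right-hand side product: the single term at `S \ i` (present iff `i ∈ S`)
  have hR : (extMulMatrix R k q i * (extMulMatrix R k q b)ᵀ) S U =
      if i ∈ S.1 ∧ U.1 = insert b (S.1.erase i) then
        wedgeSign R i (S.1.erase i) * wedgeSign R b (S.1.erase i) else 0 := by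
    rw [Matrix.mul_apply]
    by_cases hiS : i ∈ S.1
    · let W₀ : ExtIdx k q :=
        ⟨S.1.erase i, by rw [Finset.card_erase_of_mem hiS, S.2]; rfl⟩
      have hSW : S.1 = insert i W₀.1 := (Finset.insert_erase hiS).symm
      rw [Finset.sum_eq_single W₀]
      · rw [Matrix.transpose_apply, extMulMatrix_apply, extMulMatrix_apply, if_pos hSW]
        by_cases h : U.1 = insert b (S.1.erase i)
        · rw [if_pos (show U.1 = insert b W₀.1 from h), if_pos ⟨hiS, h⟩]
        · rw [if_neg (show ¬ U.1 = insert b W₀.1 from h), if_neg (fun h' => h h'.2), mul_zero]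
      · intro W _ hW
        rw [extMulMatrix_apply, if_neg, zero_mul]
        intro hSW'
        apply hW
        apply Subtype.ext
        show W.1 = S.1.erase i
        rw [hSW', Finset.erase_insert (not_mem_of_eq_insert hSW')]
      · exact fun h => absurd (Finset.mem_univ _) h
    · rw [if_neg (fun h => hiS h.1)]
      refine Finset.sum_eq_zero fun W _ => ?_
      rw [extMulMatrix_apply, if_neg, zero_mul]
      intro hSW
      exact hiS (hSW ▸ Finset.mem_insert_self i W.1)
  rw [hL, Matrix.add_apply, Matrix.neg_apply, hR]
  by_cases hib : i = b
  · subst hib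
    rw [if_pos rfl, Matrix.one_apply]
    by_cases hiS : i ∈ S.1
    · rw [if_neg (show ¬(i ∉ S.1 ∧ insert i S.1 = insert i U.1) from fun h => h.1 hiS)]
      by_cases hSU : S = U
      · subst hSU
        rw [if_pos (show i ∈ S.1 ∧ S.1 = insert i (S.1.erase i) from
          ⟨hiS, (Finset.insert_erase hiS).symm⟩), if_pos rfl, wedgeSign_mul_self]
        ring
      · have hne : ¬(i ∈ S.1 ∧ U.1 = insert i (S.1.erase i)) := by
          rintro ⟨-, hU⟩
          rw [Finset.insert_erase hiS] at hU
          exact hSU (Subtype.ext hU.symm)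
        rw [if_neg hne, if_neg hSU]
        ring
    · rw [if_neg (show ¬(i ∈ S.1 ∧ U.1 = insert i (S.1.erase i)) from fun h => hiS h.1)]
      by_cases hSU : S = U
      · subst hSU
        rw [if_pos (show i ∉ S.1 ∧ insert i S.1 = insert i S.1 from ⟨hiS, rfl⟩), if_pos rfl,
          wedgeSign_mul_self]
        ring
      · have hne : ¬(i ∉ S.1 ∧ insert i S.1 = insert i U.1) := by
          rintro ⟨-, h⟩
          apply hSU
          apply Subtype.ext
          have hiU : i ∉ U.1 := by
            intro hiU
            have hc : (insert i U.1).card = q + 2 := by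
              rw [← h, Finset.card_insert_of_notMem hiS, S.2]
            rw [Finset.insert_eq_of_mem hiU, U.2] at hc
            omega
          rw [← Finset.erase_insert hiS, h, Finset.erase_insert hiU]
        rw [if_neg hne, if_neg hSU]
        ring
  · rw [if_neg hib, Matrix.zero_apply, add_zero]
    by_cases hc : b ∉ S.1 ∧ insert b S.1 = insert i U.1
    · obtain ⟨hbS, h⟩ := hc
      have hiS : i ∈ S.1 := by
        have : i ∈ insert b S.1 := h ▸ Finset.mem_insert_self i U.1
        rcases Finset.mem_insert.1 this with h' | h'
        · exact absurd h' hib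
        · exact h'
      have hiU : i ∉ U.1 := by
        intro hiU
        have hcard : (insert i U.1).card = q + 2 := by
          rw [← h, Finset.card_insert_of_notMem hbS, S.2]
        rw [Finset.insert_eq_of_mem hiU, U.2] at hcard
        omega
      have hU : U.1 = insert b (S.1.erase i) := by
        rw [← Finset.erase_insert hiU, ← h, Finset.erase_insert_of_ne (Ne.symm hib)]
      rw [if_pos ⟨hbS, h⟩, if_pos ⟨hiS, hU⟩]
      have hbS' : b ∉ S.1.erase i := fun h' => hbS (Finset.mem_of_mem_erase h')
      have hiS' : i ∉ S.1.erase i := Finset.notMem_erase i S.1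
      have key : wedgeSign R b S.1 = wedgeSign R b (insert i (S.1.erase i)) := by
        rw [Finset.insert_erase hiS]
      rw [key, hU, wedgeSign_insert_mul_wedgeSign_insert hib hiS' hbS']
    · rw [if_neg hc]
      by_cases hc' : i ∈ S.1 ∧ U.1 = insert b (S.1.erase i)
      · exfalso
        obtain ⟨hiS, hU⟩ := hc'
        apply hc
        have hbS' : b ∉ S.1.erase i := by
          intro hb
          have hcard := U.2
          rw [hU, Finset.insert_eq_of_mem hb, Finset.card_erase_of_mem hiS, S.2] at hcard
          omega
        have hbS : b ∉ S.1 := fun hb => hbS' (Finset.mem_erase.2 ⟨Ne.symm hib, hb⟩)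
        refine ⟨hbS, ?_⟩
        rw [hU, Finset.insert_comm, Finset.insert_erase hiS]
      · rw [if_neg hc', neg_zero]

end ExteriorIdentities

section RankTools

variable {F : Type*} [Field F] {X Y Z : Type*}

/-- Subadditivity of the rank of matrices ("the rank of this matrix is at most the sum of the
ranks of the three blocks"). [cite: BlaserIkenmeyerLysikovPandeySchreyer2019, Thm. 24 (proof)] -/
theorem rank_add_le_rank_add_rank [Fintype Y] (A B : Matrix X Y F) :
    (A + B).rank ≤ A.rank + B.rank := by
  have h : LinearMap.range (A + B).mulVecLin ≤
      LinearMap.range A.mulVecLin ⊔ LinearMap.range B.mulVecLin := by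
    rintro _ ⟨v, rfl⟩
    rw [Matrix.mulVecLin_add, LinearMap.add_apply]
    exact Submodule.add_mem_sup ⟨v, rfl⟩ ⟨v, rfl⟩
  exact (Submodule.finrank_mono h).trans (Submodule.finrank_add_le_finrank_add_finrank _ _)

/-- A matrix supported on the rows satisfying `P` and the columns satisfying `Q` has rank at most
the number of such rows and at most the number of such columns ("the ranks of other two blocks are
bounded by their sizes"). [cite: BlaserIkenmeyerLysikovPandeySchreyer2019, Thm. 24 (proof)] -/
theorem rank_of_ite_and_le [Fintype X] [Fintype Z] [DecidableEq X] [DecidableEq Z]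
    (M : Matrix X Z F) (P : X → Prop) (Q : Z → Prop) [DecidablePred P] [DecidablePred Q] :
    (Matrix.of fun x z => if P x ∧ Q z then M x z else 0).rank ≤
      min (Fintype.card {x // P x}) (Fintype.card {z // Q z}) := by
  have h : (Matrix.of fun x z => if P x ∧ Q z then M x z else 0) =
      ((1 : Matrix X X F).submatrix id (Subtype.val : {x // P x} → X)) *
        M.submatrix (Subtype.val : {x // P x} → X) (Subtype.val : {z // Q z} → Z) *
        (1 : Matrix Z Z F).submatrix (Subtype.val : {z // Q z} → Z) id := by
    ext x z
    rw [Matrix.mul_apply, Matrix.of_apply]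
    by_cases hz : Q z
    · rw [Fintype.sum_eq_single (⟨z, hz⟩ : {z // Q z}) (fun y hy => ?_)]
      · have h1 : ((1 : Matrix Z Z F).submatrix (Subtype.val : {z // Q z} → Z) id) ⟨z, hz⟩ z = 1 :=
          Matrix.one_apply_eq z
        rw [h1, mul_one, Matrix.mul_apply]
        by_cases hx : P x
        · rw [if_pos ⟨hx, hz⟩, Fintype.sum_eq_single (⟨x, hx⟩ : {x // P x}) (fun y hy => ?_)]
          · have h2 : ((1 : Matrix X X F).submatrix id (Subtype.val : {x // P x} → X)) x ⟨x, hx⟩ = 1 :=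
              Matrix.one_apply_eq x
            rw [h2, one_mul]
            rfl
          · have h0 : ((1 : Matrix X X F).submatrix id (Subtype.val : {x // P x} → X)) x y = 0 :=
              Matrix.one_apply_ne (fun h : x = y.1 => hy (Subtype.ext h.symm))
            rw [h0, zero_mul]
        · rw [if_neg (fun h => hx h.1)]
          refine (Finset.sum_eq_zero fun y _ => ?_).symm
          have h0 : ((1 : Matrix X X F).submatrix id (Subtype.val : {x // P x} → X)) x y = 0 :=
            Matrix.one_apply_ne (fun h : x = y.1 => hx (h ▸ y.2))
          rw [h0, zero_mul]
      · have h0 : ((1 : Matrix Z Z F).submatrix (Subtype.val : {z // Q z} → Z) id) y z = 0 :=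
          Matrix.one_apply_ne (fun h : y.1 = z => hy (Subtype.ext h))
        rw [h0, mul_zero]
    · rw [if_neg (fun h => hz h.2)]
      refine (Finset.sum_eq_zero fun y _ => ?_).symm
      have h0 : ((1 : Matrix Z Z F).submatrix (Subtype.val : {z // Q z} → Z) id) y z = 0 :=
        Matrix.one_apply_ne (fun h : y.1 = z => hz (h ▸ y.2))
      rw [h0, mul_zero]
  rw [h]
  refine (Matrix.rank_mul_le_left _ _).trans ((Matrix.rank_mul_le_right _ _).trans ?_)
  exact le_min (Matrix.rank_le_card_height _) (Matrix.rank_le_card_width _)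

/-- Rank factorisation: every matrix is a product through `F^{rank}` (rows expressed in a basis of
the row space; cf. the column version `KumarVolk2020.exists_mul_eq_of_rank_le`).
[cite: BlaserIkenmeyerLysikovPandeySchreyer2019, Thm. 24 (proof)] -/
theorem exists_mul_eq_of_rank [Fintype X] [Fintype Y] (B : Matrix X Y F) :
    ∃ (B₁ : Matrix X (Fin B.rank) F) (B₂ : Matrix (Fin B.rank) Y F), B₁ * B₂ = B := by
  let W : Submodule F (Y → F) := Submodule.span F (Set.range B.row)
  have hW : Module.finrank F W = B.rank := (Matrix.rank_eq_finrank_span_row B).symm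
  let b : Module.Basis (Fin B.rank) F W := (Module.finBasis F W).reindex (finCongr hW)
  have hmem : ∀ x, B x ∈ W := fun x => Submodule.subset_span ⟨x, rfl⟩
  refine ⟨fun x t => b.repr ⟨B x, hmem x⟩ t, fun t y => (b t : Y → F) y, ?_⟩
  ext x y
  have h := congrArg (fun w : W => (w : Y → F) y) (b.sum_repr ⟨B x, hmem x⟩)
  simp only [Submodule.coe_sum, Submodule.coe_smul, Finset.sum_apply, Pi.smul_apply,
    smul_eq_mul] at h
  rw [Matrix.mul_apply]
  exact h

/-- `rk(c • M) ≤ rk M`. [cite: BlaserIkenmeyerLysikovPandeySchreyer2019, Thm. 24 (proof)] -/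
theorem rank_const_smul_le [Fintype X] [Fintype Y] [DecidableEq X] (c : F) (M : Matrix X Y F) :
    (c • M).rank ≤ M.rank := by
  rw [Matrix.smul_eq_diagonal_mul]
  exact Matrix.rank_mul_le_right _ _

end RankTools

section Counting

variable {k : ℕ}

/-- `|{S ∈ ExtIdx k (q+1) : a ∈ S}| = C(k − 1, q)` (remove `a`).
[cite: BlaserIkenmeyerLysikovPandeySchreyer2019, Thm. 24 (proof)] -/
theorem card_extIdx_mem (q : ℕ) (a : Fin k) :
    Fintype.card {S : ExtIdx k (q + 1) // a ∈ S.1} = (k - 1).choose q := by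
  classical
  rw [← card_extIdx_not_mem (p := q) a]
  apply Fintype.card_congr
  exact
    { toFun := fun S => ⟨⟨S.1.1.erase a, by rw [Finset.card_erase_of_mem S.2, S.1.2]; rfl⟩,
        Finset.notMem_erase a _⟩
      invFun := fun S => ⟨⟨insert a S.1.1, by rw [Finset.card_insert_of_notMem S.2, S.1.2]⟩,
        Finset.mem_insert_self a _⟩
      left_inv := fun S => Subtype.ext (Subtype.ext (Finset.insert_erase S.2))
      right_inv := fun S => Subtype.ext (Subtype.ext (Finset.erase_insert S.2)) }

/-- Row/column block sizes: `|{(S, j) : a ∈ S}| = C(k−1, q) · N`.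
[cite: BlaserIkenmeyerLysikovPandeySchreyer2019, Thm. 24 (proof)] -/
theorem card_extIdx_mem_prod (q N : ℕ) (a : Fin k) :
    Fintype.card {x : ExtIdx k (q + 1) × Fin N // a ∈ x.1.1} = (k - 1).choose q * N := by
  rw [Fintype.card_congr (Equiv.prodSubtypeFstEquivSubtypeProd (p := fun S : ExtIdx k (q + 1) =>
    a ∈ S.1)), Fintype.card_prod, card_extIdx_mem, Fintype.card_fin]

/-- Row/column block sizes: `|{(S, j) : a ∉ S}| = C(k−1, q) · N`.
[cite: BlaserIkenmeyerLysikovPandeySchreyer2019, Thm. 24 (proof)] -/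
theorem card_extIdx_not_mem_prod (q N : ℕ) (a : Fin k) :
    Fintype.card {x : ExtIdx k q × Fin N // a ∉ x.1.1} = (k - 1).choose q * N := by
  rw [Fintype.card_congr (Equiv.prodSubtypeFstEquivSubtypeProd (p := fun S : ExtIdx k q =>
    a ∉ S.1)), Fintype.card_prod, card_extIdx_not_mem, Fintype.card_fin]

end Counting

section Shear

variable {R : Type*} [CommRing R] {k : ℕ}

/-- Support of `L_{e_a} L_{e_i}ᵀ`: a nonzero entry `(S', S)` has `a ∈ S'`, and `a ∈ S` only if
`i = a`. [cite: BlaserIkenmeyerLysikovPandeySchreyer2019, Thm. 24 (proof)] -/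
theorem extMulMatrix_mul_transpose_apply_ne_zero {q : ℕ} {a i : Fin k} {S' S : ExtIdx k (q + 1)}
    (h : (extMulMatrix R k q a * (extMulMatrix R k q i)ᵀ) S' S ≠ 0) :
    a ∈ S'.1 ∧ (a ∈ S.1 → i = a) := by
  classical
  rw [Matrix.mul_apply] at h
  obtain ⟨W, -, hW⟩ := Finset.exists_ne_zero_of_sum_ne_zero h
  rw [Matrix.transpose_apply, extMulMatrix_apply, extMulMatrix_apply] at hW
  have h1 : S'.1 = insert a W.1 := by
    by_contra h'
    rw [if_neg h'] at hW
    exact hW (zero_mul _)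
  have h2 : S.1 = insert i W.1 := by
    by_contra h'
    rw [if_neg h'] at hW
    exact hW (mul_zero _)
  refine ⟨h1 ▸ Finset.mem_insert_self a W.1, fun ha => ?_⟩
  rw [h2, Finset.mem_insert] at ha
  rcases ha with ha | ha
  · exact ha.symm
  · exact absurd ha (not_mem_of_eq_insert h1)

/-- Support of the nilpotent part `N = Σ_i c_i L_{e_a} L_{e_i}ᵀ` (`c_a = 0`): a nonzero entry
`(S', S)` has `a ∈ S'` and `a ∉ S`. [cite: BlaserIkenmeyerLysikovPandeySchreyer2019, Thm. 24 (proof)] -/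
theorem shearNil_apply_ne_zero {q : ℕ} {a : Fin k} {c : Fin k → R} (hc : c a = 0)
    {S' S : ExtIdx k (q + 1)}
    (h : (∑ i, c i • (extMulMatrix R k q a * (extMulMatrix R k q i)ᵀ)) S' S ≠ 0) :
    a ∈ S'.1 ∧ a ∉ S.1 := by
  rw [Matrix.sum_apply] at h
  obtain ⟨i, -, hi⟩ := Finset.exists_ne_zero_of_sum_ne_zero h
  rw [Matrix.smul_apply, smul_eq_mul] at hi
  have hci : c i ≠ 0 := fun h0 => hi (by rw [h0, zero_mul])
  have hne := extMulMatrix_mul_transpose_apply_ne_zero (R := R)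
    (fun h0 => hi (by rw [h0, mul_zero]))
  refine ⟨hne.1, fun ha => hci ?_⟩
  rw [hne.2 ha]
  exact hc

/-- `N ∘ N = 0` for the nilpotent part of the shear. [cite: BlaserIkenmeyerLysikovPandeySchreyer2019, Thm. 24 (proof)] -/
theorem shearNil_mul_self {q : ℕ} {a : Fin k} {c : Fin k → R} (hc : c a = 0) :
    (∑ i, c i • (extMulMatrix R k q a * (extMulMatrix R k q i)ᵀ)) *
      (∑ i, c i • (extMulMatrix R k q a * (extMulMatrix R k q i)ᵀ)) = 0 := by
  ext S'' S
  rw [Matrix.mul_apply, Matrix.zero_apply]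
  refine Finset.sum_eq_zero fun S' _ => ?_
  by_cases h1 : (∑ i, c i • (extMulMatrix R k q a * (extMulMatrix R k q i)ᵀ)) S' S = 0
  · rw [h1, mul_zero]
  · have h2 : (∑ i, c i • (extMulMatrix R k q a * (extMulMatrix R k q i)ᵀ)) S'' S' = 0 := by
      by_contra h2
      exact (shearNil_apply_ne_zero hc h2).2 (shearNil_apply_ne_zero hc h1).1
    rw [h2, zero_mul]

/-- The shear `Λ^{q+1}(ψ) = 1 + N` (`ψ e_i = e_i + c_i e_a`) is invertible.
[cite: BlaserIkenmeyerLysikovPandeySchreyer2019, Thm. 24 (proof)] -/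
theorem isUnit_det_shear {q : ℕ} {a : Fin k} {c : Fin k → R} (hc : c a = 0) :
    IsUnit (1 + ∑ i, c i • (extMulMatrix R k q a * (extMulMatrix R k q i)ᵀ)).det := by
  rw [← Matrix.isUnit_iff_isUnit_det]
  exact IsNilpotent.isUnit_one_add ⟨2, by rw [pow_two, shearNil_mul_self hc]⟩

/-- **Functoriality of the exterior powers on a shear**: `Λ^{q+2}(ψ) ∘ L_{e_j} = L_{ψ e_j} ∘
Λ^{q+1}(ψ)` with `ψ e_j = e_j + c_j e_a`, for the matrices `Λ(ψ) = 1 + Σ_i c_i L_{e_a} L_{e_i}ᵀ`.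
[cite: BlaserIkenmeyerLysikovPandeySchreyer2019, Thm. 24 (proof)] -/
theorem shear_mul_extMulMatrix (q : ℕ) (a j : Fin k) (c : Fin k → R) :
    (1 + ∑ i, c i • (extMulMatrix R k (q + 1) a * (extMulMatrix R k (q + 1) i)ᵀ)) *
        extMulMatrix R k (q + 1) j =
      (extMulMatrix R k (q + 1) j + c j • extMulMatrix R k (q + 1) a) *
        (1 + ∑ i, c i • (extMulMatrix R k q a * (extMulMatrix R k q i)ᵀ)) := by
  have hterm : ∀ i, (c i • (extMulMatrix R k (q + 1) a * (extMulMatrix R k (q + 1) i)ᵀ)) *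
      extMulMatrix R k (q + 1) j =
      c i • (extMulMatrix R k (q + 1) j * (extMulMatrix R k q a * (extMulMatrix R k q i)ᵀ)) +
        (if j = i then c i • extMulMatrix R k (q + 1) a else 0) := by
    intro i
    rw [Matrix.smul_mul, Matrix.mul_assoc, extMulMatrix_transpose_mul_extMulMatrix, Matrix.mul_add,
      Matrix.mul_neg, ← Matrix.mul_assoc, extMulMatrix_succ_mul_extMulMatrix_comm, Matrix.neg_mul,
      neg_neg, Matrix.mul_assoc, smul_add]
    by_cases hji : j = i
    · rw [if_pos hji, if_pos hji, Matrix.mul_one]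
    · rw [if_neg hji, if_neg hji, Matrix.mul_zero, smul_zero]
  have hleft : (∑ i, c i • (extMulMatrix R k (q + 1) a * (extMulMatrix R k (q + 1) i)ᵀ)) *
      extMulMatrix R k (q + 1) j =
      (∑ i, c i • (extMulMatrix R k (q + 1) j * (extMulMatrix R k q a * (extMulMatrix R k q i)ᵀ))) +
        c j • extMulMatrix R k (q + 1) a := by
    rw [Matrix.sum_mul]
    simp_rw [hterm]
    rw [Finset.sum_add_distrib, Finset.sum_ite_eq]
    simp
  have hright : extMulMatrix R k (q + 1) j *
      (∑ i, c i • (extMulMatrix R k q a * (extMulMatrix R k q i)ᵀ)) =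
      ∑ i, c i • (extMulMatrix R k (q + 1) j * (extMulMatrix R k q a * (extMulMatrix R k q i)ᵀ)) := by
    rw [Matrix.mul_sum]
    simp_rw [Matrix.mul_smul]
  have hzero : extMulMatrix R k (q + 1) a *
      (∑ i, c i • (extMulMatrix R k q a * (extMulMatrix R k q i)ᵀ)) = 0 := by
    rw [Matrix.mul_sum]
    refine Finset.sum_eq_zero fun i _ => ?_
    rw [Matrix.mul_smul, ← Matrix.mul_assoc, extMulMatrix_succ_mul_extMulMatrix_self,
      Matrix.zero_mul, smul_zero]
  rw [Matrix.add_mul, Matrix.one_mul, hleft, Matrix.mul_add, Matrix.mul_one, Matrix.add_mul, hright,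
    Matrix.smul_mul, hzero, smul_zero, add_zero]
  abel

end Shear

section Kronecker

open scoped Kronecker

variable {F : Type*} [Field F] {k m n : ℕ}

/-- Entries of the Koszul flattening matrix in terms of `L_{e_i}`: the defining condition
`S_b ⊆ S_c ∧ i ∈ S_c ∧ i ∉ S_b` is `S_c = S_b ∪ {i}`.
[cite: BlaserIkenmeyerLysikovPandeySchreyer2019, §7.2 (F_{T,p})] -/
theorem koszulMatrix_apply_eq (p : ℕ) (T : Fin k → Fin m → Fin n → F)
    (Sc : ExtIdx k (p + 1) × Fin n) (Sb : ExtIdx k p × Fin m) :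
    koszulMatrix p T Sc Sb = ∑ i, extMulMatrix F k p i Sc.1 Sb.1 * T i Sb.2 Sc.2 := by
  unfold koszulMatrix
  refine Finset.sum_congr rfl fun i _ => ?_
  rw [extMulMatrix_apply]
  by_cases h : Sc.1.1 = insert i Sb.1.1
  · have hi : i ∉ Sb.1.1 := not_mem_of_eq_insert h
    have hsub : Sb.1.1 ⊆ Sc.1.1 := by rw [h]; exact Finset.subset_insert i _
    have hmem : i ∈ Sc.1.1 := by rw [h]; exact Finset.mem_insert_self i _
    rw [if_pos ⟨hsub, hmem, hi⟩, if_pos h]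
  · rw [if_neg h, zero_mul, if_neg]
    rintro ⟨hsub, hmem, hi⟩
    apply h
    symm
    apply Finset.eq_of_subset_of_card_le (Finset.insert_subset hmem hsub)
    rw [Finset.card_insert_of_notMem hi, Sc.1.2, Sb.1.2]

/-- **`F_{T,p} = Σ_i L_{e_i} ⊗ A_i`** ("If `T = Σ_i x_i ⊗ A_i`, then `F_{T,p}` sends `y ⊗ v` to
`Σ_i (x_i ∧ y) ⊗ A_i v`"). [cite: BlaserIkenmeyerLysikovPandeySchreyer2019, §7.2 (F_{T,p})] -/
theorem koszulMatrix_eq_sum_kronecker (p : ℕ) (T : Fin k → Fin m → Fin n → F) :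
    koszulMatrix p T = ∑ i, extMulMatrix F k p i ⊗ₖ Matrix.of (fun d b => T i b d) := by
  ext Sc Sb
  rw [koszulMatrix_apply_eq, Matrix.sum_apply]
  refine Finset.sum_congr rfl fun i _ => ?_
  rcases Sc with ⟨S, d⟩
  rcases Sb with ⟨S', b⟩
  rw [Matrix.kronecker_apply, Matrix.of_apply]

/-- **Conjugating the Koszul flattening by a shear of `U`**: with `ψ e_j = e_j + c_j e_a`,
`(Λ(ψ) ⊗ 1) F_{T,p+1} = F_{T',p+1} (Λ(ψ) ⊗ 1)` where `T'` has the same slices as `T` except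
`A'_a = A_a + Σ_j c_j A_j`. [cite: BlaserIkenmeyerLysikovPandeySchreyer2019, Thm. 24 (proof)] -/
theorem shear_kronecker_mul_koszulMatrix (p : ℕ) (T : Fin k → Fin m → Fin n → F) (a : Fin k)
    (c : Fin k → F) :
    ((1 + ∑ i, c i • (extMulMatrix F k (p + 1) a * (extMulMatrix F k (p + 1) i)ᵀ)) ⊗ₖ
        (1 : Matrix (Fin n) (Fin n) F)) * koszulMatrix (p + 1) T =
      koszulMatrix (p + 1) (fun l b d => T l b d + if l = a then ∑ j, c j * T j b d else 0) *
        ((1 + ∑ i, c i • (extMulMatrix F k p a * (extMulMatrix F k p i)ᵀ)) ⊗ₖ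
          (1 : Matrix (Fin m) (Fin m) F)) := by
  rw [koszulMatrix_eq_sum_kronecker, koszulMatrix_eq_sum_kronecker, Matrix.mul_sum, Matrix.sum_mul]
  have hl : ∀ l, ((1 + ∑ i, c i • (extMulMatrix F k (p + 1) a * (extMulMatrix F k (p + 1) i)ᵀ)) ⊗ₖ
      (1 : Matrix (Fin n) (Fin n) F)) * (extMulMatrix F k (p + 1) l ⊗ₖ Matrix.of (fun d b => T l b d)) =
      ((extMulMatrix F k (p + 1) l + c l • extMulMatrix F k (p + 1) a) ⊗ₖ
        Matrix.of (fun d b => T l b d)) *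
      ((1 + ∑ i, c i • (extMulMatrix F k p a * (extMulMatrix F k p i)ᵀ)) ⊗ₖ
        (1 : Matrix (Fin m) (Fin m) F)) := by
    intro l
    rw [← Matrix.mul_kronecker_mul, ← Matrix.mul_kronecker_mul, shear_mul_extMulMatrix,
      Matrix.one_mul, Matrix.mul_one]
  simp_rw [hl]
  rw [← Matrix.sum_mul, ← Matrix.sum_mul]
  congr 1
  ext ⟨S, d⟩ ⟨S', b⟩
  simp only [Matrix.sum_apply, Matrix.kronecker_apply, Matrix.of_apply, Matrix.add_apply,
    Matrix.smul_apply, smul_eq_mul]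
  simp only [add_mul, mul_add, Finset.sum_add_distrib, mul_ite, mul_zero, Finset.sum_ite_eq',
    Finset.mem_univ, if_true, Finset.mul_sum]
  congr 1
  refine Finset.sum_congr rfl fun j _ => ?_
  ring

/-- **Rank invariance under the shear**: `rk F_{T,p+1} = rk F_{T',p+1}` (`c_a = 0`).
[cite: BlaserIkenmeyerLysikovPandeySchreyer2019, Thm. 24 (proof)] -/
theorem rank_koszulMatrix_shear (p : ℕ) (T : Fin k → Fin m → Fin n → F) (a : Fin k)
    {c : Fin k → F} (hc : c a = 0) :
    (koszulMatrix (p + 1) T).rank =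
      (koszulMatrix (p + 1) (fun l b d => T l b d + if l = a then ∑ j, c j * T j b d else 0)).rank := by
  have hu' : IsUnit (((1 + ∑ i, c i • (extMulMatrix F k (p + 1) a * (extMulMatrix F k (p + 1) i)ᵀ)) ⊗ₖ
      (1 : Matrix (Fin n) (Fin n) F))).det := by
    rw [Matrix.det_kronecker, Matrix.det_one, one_pow, mul_one]
    exact (isUnit_det_shear hc).pow _
  have hu : IsUnit (((1 + ∑ i, c i • (extMulMatrix F k p a * (extMulMatrix F k p i)ᵀ)) ⊗ₖ
      (1 : Matrix (Fin m) (Fin m) F))).det := by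
    rw [Matrix.det_kronecker, Matrix.det_one, one_pow, mul_one]
    exact (isUnit_det_shear hc).pow _
  rw [← Matrix.rank_mul_eq_right_of_isUnit_det _ (koszulMatrix (p + 1) T) hu',
    shear_kronecker_mul_koszulMatrix, Matrix.rank_mul_eq_left_of_isUnit_det _ _ hu]

end Kronecker

section Main

open scoped Kronecker

variable {F : Type*} [Field F] {k m n : ℕ}

/-- **The block `(I_p u) ⊗ A`**: `rk(L_{e_a} ⊗ B) ≤ C(k−1, p) · rk B` ("The block `I_p u ⊗ A`
has rank `dim Λ^p H · rk A = C(k−1,p) r`"). [cite: BlaserIkenmeyerLysikovPandeySchreyer2019, Thm. 24 (proof)] -/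
theorem rank_extMulMatrix_kronecker_le (p : ℕ) (a : Fin k) (B : Matrix (Fin n) (Fin m) F) :
    (extMulMatrix F k p a ⊗ₖ B).rank ≤ (k - 1).choose p * B.rank := by
  classical
  obtain ⟨B₁, B₂, hB⟩ := exists_mul_eq_of_rank B
  have hL : extMulMatrix F k p a =
      ((1 : Matrix (ExtIdx k (p + 1)) (ExtIdx k (p + 1)) F).submatrix id
          (Subtype.val : {S : ExtIdx k (p + 1) // a ∈ S.1} → ExtIdx k (p + 1))) *
        (extMulMatrix F k p a).submatrix
          (Subtype.val : {S : ExtIdx k (p + 1) // a ∈ S.1} → ExtIdx k (p + 1)) id := by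
    ext S S'
    rw [Matrix.mul_apply]
    by_cases ha : a ∈ S.1
    · rw [Fintype.sum_eq_single (⟨S, ha⟩ : {S : ExtIdx k (p + 1) // a ∈ S.1}) (fun y hy => ?_)]
      · have h1 : ((1 : Matrix (ExtIdx k (p + 1)) (ExtIdx k (p + 1)) F).submatrix id
            (Subtype.val : {S : ExtIdx k (p + 1) // a ∈ S.1} → ExtIdx k (p + 1))) S ⟨S, ha⟩ = 1 :=
          Matrix.one_apply_eq S
        rw [h1, one_mul]
        rfl
      · have h0 : ((1 : Matrix (ExtIdx k (p + 1)) (ExtIdx k (p + 1)) F).submatrix id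
            (Subtype.val : {S : ExtIdx k (p + 1) // a ∈ S.1} → ExtIdx k (p + 1))) S y = 0 :=
          Matrix.one_apply_ne (fun h : S = y.1 => hy (Subtype.ext h.symm))
        rw [h0, zero_mul]
    · rw [extMulMatrix_apply,
        if_neg (fun h : S.1 = insert a S'.1 => ha (h ▸ Finset.mem_insert_self a S'.1))]
      refine (Finset.sum_eq_zero fun y _ => ?_).symm
      have h0 : ((1 : Matrix (ExtIdx k (p + 1)) (ExtIdx k (p + 1)) F).submatrix id
          (Subtype.val : {S : ExtIdx k (p + 1) // a ∈ S.1} → ExtIdx k (p + 1))) S y = 0 :=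
        Matrix.one_apply_ne (fun h : S = y.1 => ha (h ▸ y.2))
      rw [h0, zero_mul]
  have key : (extMulMatrix F k p a ⊗ₖ B).rank ≤
      Fintype.card ({S : ExtIdx k (p + 1) // a ∈ S.1} × Fin B.rank) := by
    conv_lhs => rw [hL, ← hB, Matrix.mul_kronecker_mul]
    exact (Matrix.rank_mul_le_right _ _).trans (Matrix.rank_le_card_height _)
  rw [Fintype.card_prod, card_extIdx_mem, Fintype.card_fin] at key
  exact key

/-- If the `a`-th slice of `T` vanishes, a nonzero entry of `F_{T,p}` has `a ∈ S_c ↔ a ∈ S_b`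
(the two diagonal blocks `F_{T',p}`, `F_{T',p-1}` of the printed `2 × 2` block matrix).
[cite: BlaserIkenmeyerLysikovPandeySchreyer2019, Thm. 24 (proof)] -/
theorem mem_iff_mem_of_koszulMatrix_ne_zero (p : ℕ) {T : Fin k → Fin m → Fin n → F} {a : Fin k}
    (hT : ∀ b d, T a b d = 0) {Sc : ExtIdx k (p + 1) × Fin n} {Sb : ExtIdx k p × Fin m}
    (h : koszulMatrix p T Sc Sb ≠ 0) : a ∈ Sc.1.1 ↔ a ∈ Sb.1.1 := by
  rw [koszulMatrix_apply_eq] at h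
  obtain ⟨i, -, hi⟩ := Finset.exists_ne_zero_of_sum_ne_zero h
  have hia : i ≠ a := by
    rintro rfl
    exact hi (by rw [hT, mul_zero])
  rw [extMulMatrix_apply] at hi
  have hS : Sc.1.1 = insert i Sb.1.1 := by
    by_contra h'
    rw [if_neg h'] at hi
    exact hi (zero_mul _)
  rw [hS, Finset.mem_insert]
  exact ⟨fun h' => h'.resolve_left (Ne.symm hia), fun h' => Or.inr h'⟩

/-- Block-diagonal decomposition of `F_{T,p}` when the `a`-th slice of `T` vanishes.
[cite: BlaserIkenmeyerLysikovPandeySchreyer2019, Thm. 24 (proof)] -/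
theorem koszulMatrix_eq_add_of_slice_zero (p : ℕ) {T : Fin k → Fin m → Fin n → F} {a : Fin k}
    (hT : ∀ b d, T a b d = 0) :
    koszulMatrix p T =
      (Matrix.of fun x z => if a ∉ x.1.1 ∧ a ∉ z.1.1 then koszulMatrix p T x z else 0) +
        Matrix.of fun x z => if a ∈ x.1.1 ∧ a ∈ z.1.1 then koszulMatrix p T x z else 0 := by
  ext x z
  rw [Matrix.add_apply, Matrix.of_apply, Matrix.of_apply]
  by_cases h0 : koszulMatrix p T x z = 0
  · rw [h0]
    simp
  · have hiff := mem_iff_mem_of_koszulMatrix_ne_zero p hT h0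
    by_cases hx : a ∈ x.1.1
    · rw [if_neg (fun h => h.1 hx), if_pos ⟨hx, hiff.1 hx⟩, zero_add]
    · rw [if_pos ⟨hx, fun hz => hx (hiff.2 hz)⟩, if_neg (fun h => hx h.1), add_zero]

/-- Rank of `F_{T,p+1}` when the `a`-th slice vanishes: the two diagonal blocks are bounded by
their sizes, `C(k−1,p+2)n × C(k−1,p+1)m` and `C(k−1,p+1)n × C(k−1,p)m`.
[cite: BlaserIkenmeyerLysikovPandeySchreyer2019, Thm. 24 (proof)] -/
theorem rank_koszulMatrix_le_of_slice_zero (p : ℕ) {T : Fin k → Fin m → Fin n → F} {a : Fin k}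
    (hT : ∀ b d, T a b d = 0) :
    (koszulMatrix (p + 1) T).rank ≤
      min ((k - 1).choose (p + 1 + 1) * n) ((k - 1).choose (p + 1) * m) +
        min ((k - 1).choose (p + 1) * n) ((k - 1).choose p * m) := by
  rw [koszulMatrix_eq_add_of_slice_zero (p + 1) hT]
  refine (rank_add_le_rank_add_rank _ _).trans (add_le_add ?_ ?_)
  · refine (rank_of_ite_and_le _ _ _).trans (le_of_eq ?_)
    rw [card_extIdx_not_mem_prod, card_extIdx_not_mem_prod]
  · refine (rank_of_ite_and_le _ _ _).trans (le_of_eq ?_)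
    rw [card_extIdx_mem_prod, card_extIdx_mem_prod]

/-- `F_{T',p} = F_{T₀,p} + L_{e_a} ⊗ A'_a` where `T₀` is `T'` with the `a`-th slice removed
(lower-left block `(I_p u) ⊗ A` split off). [cite: BlaserIkenmeyerLysikovPandeySchreyer2019, Thm. 24 (proof)] -/
theorem koszulMatrix_shift_eq_add (p : ℕ) (T : Fin k → Fin m → Fin n → F) (a : Fin k)
    (c : Fin k → F) :
    koszulMatrix p (fun l b d => T l b d + if l = a then ∑ j, c j * T j b d else 0) =
      koszulMatrix p (fun l b d => if l = a then 0 else T l b d) +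
        extMulMatrix F k p a ⊗ₖ Matrix.of (fun d b => T a b d + ∑ j, c j * T j b d) := by
  ext ⟨S, d⟩ ⟨S', b⟩
  rw [Matrix.add_apply, koszulMatrix_apply_eq, koszulMatrix_apply_eq, Matrix.kronecker_apply,
    Matrix.of_apply]
  have hterm : ∀ i, extMulMatrix F k p i S S' * (T i b d + if i = a then ∑ j, c j * T j b d else 0) =
      extMulMatrix F k p i S S' * (if i = a then 0 else T i b d) +
        (if i = a then extMulMatrix F k p a S S' * (T a b d + ∑ j, c j * T j b d) else 0) := by
    intro i
    by_cases hi : i = a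
    · subst hi
      simp
    · simp [hi]
  simp only [hterm]
  rw [Finset.sum_add_distrib, Finset.sum_ite_eq' Finset.univ a, if_pos (Finset.mem_univ a)]

/-- **BILPS Thm 24, natural-number form.** For `T ∈ 𝓜_r` and `0 < p`:
`rk F_{T,p} ≤ C(k−1,p)·r + min(C(k−1,p+1)n, C(k−1,p)m) + min(C(k−1,p)n, C(k−1,p−1)m)`.
[cite: BlaserIkenmeyerLysikovPandeySchreyer2019, Thm. 24] -/
theorem rank_koszulMatrix_le_of_mem_minrankSet {p r : ℕ} {T : Fin k → Fin m → Fin n → F}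
    (hp : 0 < p) (hT : T ∈ (minrankSet F r : Set (Fin k → Fin m → Fin n → F))) :
    (koszulMatrix p T).rank ≤ (k - 1).choose p * r +
      (min ((k - 1).choose (p + 1) * n) ((k - 1).choose p * m) +
        min ((k - 1).choose p * n) ((k - 1).choose (p - 1) * m)) := by
  classical
  obtain ⟨x, hx, hr⟩ := hT
  obtain ⟨a, ha⟩ := Function.ne_iff.1 hx
  replace ha : x a ≠ 0 := ha
  obtain ⟨p', rfl⟩ : ∃ p', p = p' + 1 := ⟨p - 1, by omega⟩
  obtain ⟨c, hc⟩ : ∃ c : Fin k → F, c = fun l => if l = a then 0 else x l / x a := ⟨_, rfl⟩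
  have hca : c a = 0 := by rw [hc]; simp
  rw [rank_koszulMatrix_shear p' T a hca, koszulMatrix_shift_eq_add, Nat.add_sub_cancel]
  refine (rank_add_le_rank_add_rank _ _).trans ?_
  rw [add_comm ((k - 1).choose (p' + 1) * r)]
  refine add_le_add (rank_koszulMatrix_le_of_slice_zero p'
    (T := fun l b d => if l = a then 0 else T l b d) (a := a) (fun b d => if_pos rfl)) ?_
  refine (rank_extMulMatrix_kronecker_le _ _ _).trans (Nat.mul_le_mul_left _ ?_)
  have hmat : Matrix.of (fun d b => T a b d + ∑ j, c j * T j b d) = (x a)⁻¹ • (contract3 T x)ᵀ := by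
    ext d b
    rw [Matrix.of_apply, Matrix.smul_apply, Matrix.transpose_apply, contract3_apply, smul_eq_mul,
      Finset.mul_sum]
    have hj : ∀ j, (x a)⁻¹ * (x j * T j b d) = c j * T j b d + if j = a then T a b d else 0 := by
      intro j
      rw [hc]
      by_cases hja : j = a
      · subst hja
        simp [inv_mul_cancel_left₀ ha]
      · simp [hja, div_eq_mul_inv]
        ring
    simp only [hj]
    rw [Finset.sum_add_distrib, Finset.sum_ite_eq' Finset.univ a, if_pos (Finset.mem_univ a), add_comm]
  rw [hmat]
  refine (rank_const_smul_le _ _).trans ?_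
  rw [Matrix.rank_transpose]
  exact hr

/-- The binomial bookkeeping of the printed bound: `C(k−1,p+1) = C(k−1,p)·(k−p−1)/(p+1)`.
[cite: BlaserIkenmeyerLysikovPandeySchreyer2019, Thm. 24 (proof)] -/
theorem cast_choose_succ_eq {p : ℕ} (hpk : p < k) :
    ((k - 1).choose (p + 1) : ℚ) = (k - 1).choose p * (((k : ℚ) - p - 1) / (p + 1)) := by
  have h := Nat.choose_succ_right_eq (k - 1) p
  have hc : (((k - 1).choose (p + 1) : ℕ) : ℚ) * ((p : ℚ) + 1) = ((k - 1).choose p : ℕ) * ((k : ℚ) - p - 1) := by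
    have h' := congrArg (Nat.cast : ℕ → ℚ) h
    push_cast at h'
    have e : (((k - 1 - p : ℕ) : ℚ)) = (k : ℚ) - p - 1 := by
      rw [Nat.cast_sub (by omega), Nat.cast_sub (by omega)]
      push_cast
      ring
    rw [e] at h'
    exact h'
  have hp1 : (p : ℚ) + 1 ≠ 0 := by positivity
  field_simp
  linarith [hc]

/-- The binomial bookkeeping of the printed bound: `C(k−1,p−1) = C(k−1,p)·p/(k−p)` (`0 < p < k`).
[cite: BlaserIkenmeyerLysikovPandeySchreyer2019, Thm. 24 (proof)] -/
theorem cast_choose_pred_eq {p : ℕ} (hp : 0 < p) (hpk : p < k) :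
    ((k - 1).choose (p - 1) : ℚ) = (k - 1).choose p * ((p : ℚ) / ((k : ℚ) - p)) := by
  obtain ⟨q, rfl⟩ : ∃ q, p = q + 1 := ⟨p - 1, by omega⟩
  have h := Nat.choose_succ_right_eq (k - 1) q
  have hc : (((k - 1).choose (q + 1) : ℕ) : ℚ) * ((q : ℚ) + 1) =
      ((k - 1).choose q : ℕ) * ((k : ℚ) - (q + 1)) := by
    have h' := congrArg (Nat.cast : ℕ → ℚ) h
    push_cast at h'
    have e : (((k - 1 - q : ℕ) : ℚ)) = (k : ℚ) - (q + 1) := by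
      rw [Nat.cast_sub (by omega), Nat.cast_sub (by omega)]
      push_cast
      ring
    rw [e] at h'
    exact h'
  have hkq : (k : ℚ) - (q + 1) ≠ 0 := by
    have : ((q : ℚ) + 1) < k := by exact_mod_cast hpk
    linarith
  rw [Nat.add_sub_cancel]
  push_cast
  field_simp
  linarith [hc]

/-- **BILPS Thm 24 (Koszul flattening rank bound) — DISCHARGED.** The printed `2 × 2` block proof,
executed in the standard basis after conjugating `F_{T,p}` by the exterior powers of a shear of
`U` that moves the minrank witness `x` to a coordinate vector; valid over every field.
[cite: BlaserIkenmeyerLysikovPandeySchreyer2019, Thm. 24] -/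
theorem BILPS2019_thm24_holds : BILPS2019_thm24 := by
  intro F _ _ _ k m n p r T hp hpk hT
  have h := rank_koszulMatrix_le_of_mem_minrankSet hp hT
  have hcast : ((koszulMatrix p T).rank : ℚ) ≤ (((k - 1).choose p * r +
      (min ((k - 1).choose (p + 1) * n) ((k - 1).choose p * m) +
        min ((k - 1).choose p * n) ((k - 1).choose (p - 1) * m)) : ℕ) : ℚ) := by
    exact_mod_cast h
  refine hcast.trans (le_of_eq ?_)
  have hC : (0 : ℚ) ≤ (k - 1).choose p := Nat.cast_nonneg _
  push_cast
  rw [cast_choose_succ_eq hpk, cast_choose_pred_eq hp hpk, mul_add, mul_add,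
    mul_min_of_nonneg _ _ hC, mul_min_of_nonneg _ _ hC, min_comm (((k - 1).choose p : ℚ) * (m : ℚ))]
  ring_nf

/-- **BILPS Cor 25 — DISCHARGED**, by name, from the proved Thm 24 through the landed glue
`BILPS2019_cor25_of_thm24` (`BILPS19Cor25OfThm24.lean`, the printed arithmetic).
[cite: BlaserIkenmeyerLysikovPandeySchreyer2019, Cor. 25] -/
theorem BILPS2019_cor25_holds : BILPS2019_cor25 :=
  BILPS2019_cor25_of_thm24 BILPS2019_thm24_holds

end Main

end Literature.Computability.AlgebraicComplexity
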